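import Summits.CriticalPhenomena.PercolationContinuityZ3.Theorems.PercGamblersRuinBGNOffTheFloorThreshold
import HarnessLib

/-!
# Line `SublinearProfileBGN` (profile ladder) on crux `BGNOffTheFloor` (stmt-CriticalPhenomena-7773)

Forward generator G4 `ladder-down`, top `C = Theses.PercGamblersRuin.BGNOffTheFloor`
(landed `C ↔ S` modulo `X_D`: `Theorems.OffFloor.bgnOffTheFloor_iff_continuity_of_linearScaleLROOfTheta`;
landed `S → C`: `Theorems.OffFloor.bgnOffTheFloor_of_percolationContinuityZ3`).

Language of `C`: the CLIMB PROBABILITY `climb A L = P_{p_c}(E(A,L))`,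
`E(A,L) = {ω | ∃ y, y₀ = L ∧ 0 ⟷ y inside {z | -A < z₀}}` (reach the level `L` above a floor at
depth `A`), so that `C` reads `∀ a < b, liminf_n climb (a n) (b n) = 0`.

GRADATION PARAMETER (this line): the DEPTH PROFILE `g : ℕ → ℕ` (floor depth as a function of the
height to climb).  `ProfileBGN 𝒢 := ∀ g ∈ 𝒢, climb (g L) L → 0`.
* floor  `𝒢 = constProfiles`  — PROVED (Barsky–Grimmett–Newman at every fixed depth,
  `profileBGN_constProfiles` below, sorry-free, from `StubCeiling.real_percolatesVia_halfSpace_depth`);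
* RUNG   `𝒢 = sublinearProfiles` (`g = o(L)`) — `SublinearProfileBGN`, OPEN, crux #1 of the line
  (equivalently: BGN holds UNIFORMLY in the starting depth, `sup_n climb n (b n) → 0` as `b → ∞`);
* top    linear depth `a n` under the ceiling `b n`, `a < b` — `LinearDepthBGN` (the crux `C` in
  `lim`-mode; `LinearDepthBGN → C` is `bgnOffTheFloor_of_linearDepthBGN`, two lines);
* `g = id` (diagonal) ⟺ `S` (`Theorems.OffFloor.offFloor_diag_iff`).
The passage sublinear → linear (`stub_passageToLinearDepth`) is the X_D wall: every linear-depth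
rung is conjunct-equivalent modulo `PercFiniteBoxLRO.LinearScaleLROOfTheta` (p153598), while the
sublinear rungs are X_D-compatible (LRO chaining only gives `climb (L^α) (b L) ≥ ρ^{K b L^{1-α}} → 0`).
It is flagged summit-strength-mod-X_D in the line card and is NOT a prover target.
-/

noncomputable section

namespace Summit.CriticalPhenomena.PercolationContinuityZ3.Cruxes.BGNOffTheFloor.ProfileLadder

open MeasureTheory Filter Asymptotics Literature.Probability.Percolation Literature.Probability.LatticeModels
open Summit.CriticalPhenomena.PercolationContinuityZ3.Theorems
open scoped Topology

/-! ### The climb language of the crux -/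

/-- The climb event `E(A, L)`: the origin is joined inside `{z | -A < z₀}` to a site of height `L`
(verbatim the event of `Theses.PercGamblersRuin.BGNOffTheFloor` at `A = a n`, `L = b n`). -/
def climbEvt (A L : ℕ) : Set (BondConfig (Site 3)) :=
  {ω | ∃ y : Site 3, y 0 = (L : ℤ) ∧ ω ∈ openConnIn {z : Site 3 | -(A : ℤ) < z 0} 0 y}

/-- The climb probability `climb A L = P_{p_c(ℤ³)}(E(A, L))`. -/
def climb (A L : ℕ) : ℝ :=
  (bondPercolation (zdGraph 3) (criticalProbI 3)).real (climbEvt A L)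

/-- The PROFILE family: Barsky–Grimmett–Newman with a floor receding along the depth profiles of
`𝒢` — for every `g ∈ 𝒢`, `climb (g L) L → 0` as `L → ∞`. Antitone in `𝒢`. -/
def ProfileBGN (𝒢 : Set (ℕ → ℕ)) : Prop :=
  ∀ g ∈ 𝒢, Tendsto (fun L : ℕ => climb (g L) L) atTop (𝓝 0)

/-- Constant profiles (fixed depth): the PROVED floor of the ladder (BGN). -/
def constProfiles : Set (ℕ → ℕ) := Set.range fun A : ℕ => fun _ : ℕ => A

/-- Sublinear profiles `g(L) = o(L)`: the NEXT RUNG. -/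
def sublinearProfiles : Set (ℕ → ℕ) :=
  {g | (fun L : ℕ => (g L : ℝ)) =o[atTop] fun L : ℕ => (L : ℝ)}

/-- **RUNG (crux #1 of the line).** `SublinearProfileBGN`: at `p_c(ℤ³)`, for every depth profile
`g = o(L)`, the probability of climbing to height `L` from depth `g(L)` above a floor, inside the
region above the floor, tends to `0`.  Equivalent (given BGN and the two monotonicities
`OffFloor.climb_real_mono`) to UNIFORM BGN: `sup_{n ≥ 1} climb n (b n) → 0` as `b → ∞`. -/
def SublinearProfileBGN : Prop := ProfileBGN sublinearProfiles

/-- Uniform BGN (banked sibling form of the rung; equivalence with `SublinearProfileBGN` is a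
support lemma for provers, not proved here): for every `ε > 0` some aspect ratio `b` makes the climb
of `b n` from depth `n` `ε`-unlikely at EVERY scale `n ≥ 1`. -/
def UniformDepthBGN : Prop :=
  ∀ ε : ℝ, 0 < ε → ∃ b : ℕ, ∀ n : ℕ, 1 ≤ n → climb n (b * n) < ε

/-- Power profiles `g(L) = ⌈L^α⌉`, `0 ≤ α ≤ 1` (banked sub-rungs: `α = 0` is the floor, every
`α < 1` is below the rung, `α = 1` is the diagonal `⟺ S`). -/
def powerProfile (α : ℝ) : ℕ → ℕ := fun L => ⌈(L : ℝ) ^ α⌉₊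

/-- `PowerProfileBGN α := ProfileBGN {powerProfile α}`. -/
def PowerProfileBGN (α : ℝ) : Prop := ProfileBGN {powerProfile α}

/-- Logarithmic profiles `g(L) = ⌈c log L⌉₊ + 1` (banked lowest sub-rung: for
`c < κ / log (1/p_c)` it follows from the height form of `QuantitativeBGN` (stmt-CriticalPhenomena-0913,
rate `κ`) by finite energy, `climb A L ≤ p_c^{-(A-1)} climb 1 L`). -/
def logProfile (c : ℝ) : ℕ → ℕ := fun L => ⌈c * Real.log L⌉₊ + 1

/-- `LogProfileBGN c := ProfileBGN {logProfile c}`. -/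
def LogProfileBGN (c : ℝ) : Prop := ProfileBGN {logProfile c}

/-- **TOP of the profile ladder in the crux's own indexation** (`lim`-mode of the crux): for all
`a < b`, `climb (a n) (b n) → 0`.  Conjunct-equivalent modulo X_D (p153598 + `offFloor_diag_iff`). -/
def LinearDepthBGN : Prop :=
  ∀ a b : ℕ, a < b → Tendsto (fun n : ℕ => climb (a * n) (b * n)) atTop (𝓝 0)

/-! ### Structure (all sorry-free) -/

/-- `ProfileBGN` is antitone in the profile class. -/
theorem profileBGN_anti {𝒢 𝒢' : Set (ℕ → ℕ)} (h : 𝒢 ⊆ 𝒢') (h' : ProfileBGN 𝒢') : ProfileBGN 𝒢 :=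
  fun g hg => h' g (h hg)

/-- Constant profiles are sublinear: the rung contains the floor. -/
theorem constProfiles_subset_sublinearProfiles : constProfiles ⊆ sublinearProfiles := by
  rintro g ⟨A, rfl⟩
  show (fun L : ℕ => ((A : ℕ) : ℝ)) =o[atTop] fun L : ℕ => (L : ℝ)
  refine (isLittleO_const_left).2 (Or.inr ?_)
  exact tendsto_norm_atTop_atTop.comp tendsto_natCast_atTop_atTop

/-- ON-PATH certificate (F4): `S → ProfileBGN 𝒢` for EVERY class `𝒢` (the climb event lies in the
one-arm event `{0 ⟷ ∂Λ_L}`, `OffFloor.tendsto_climb_of_theta_eq_zero`). -/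
theorem profileBGN_of_percolationContinuityZ3 (h : _root_.PercolationContinuityZ3)
    (𝒢 : Set (ℕ → ℕ)) : ProfileBGN 𝒢 := by
  intro g _
  have ht := OffFloor.tendsto_climb_of_theta_eq_zero (percolationContinuityZ3_iff.1 h)
    (fun L => ((g L : ℕ) : ℤ)) (b := 1) le_rfl
  refine ht.congr fun L => ?_
  simp only [climb, climbEvt, one_mul]

/-- ON-PATH certificate for the top: `S → LinearDepthBGN`. -/
theorem linearDepthBGN_of_percolationContinuityZ3 (h : _root_.PercolationContinuityZ3) :
    LinearDepthBGN := by
  intro a b hab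
  have hb : 1 ≤ b := by omega
  have ht := OffFloor.tendsto_climb_of_theta_eq_zero (percolationContinuityZ3_iff.1 h)
    (fun n => ((a * n : ℕ) : ℤ)) hb
  refine ht.congr fun n => ?_
  simp only [climb, climbEvt]

/-! ### The floor: BGN at every fixed depth (WITNESS, F3/BC5) -/

/-- For the depth `A = 0` the climb event is empty (the origin is not in `{z | 0 < z₀}`). -/
theorem climbEvt_zero_left (L : ℕ) : climbEvt 0 L = ∅ := by
  ext ω
  simp only [climbEvt, Set.mem_setOf_eq, Set.mem_empty_iff_false, iff_false, openConnIn]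
  rintro ⟨y, -, hx, -, -⟩
  simp at hx

/-- **BGN at fixed depth, climb form**: for every `A`, `climb A L → 0` as `L → ∞`.
Continuity from above along the decreasing events `{0 ⟷ height ≥ L in R(A)}`, whose intersection
is a.s. contained in `{0 ⟷ ∞ in R(A)}`, an event of probability `0` at `p_c`
(`StubCeiling.real_percolatesVia_halfSpace_depth`, Barsky–Grimmett–Newman, Grimmett 1999 Thm (7.35)). -/
theorem tendsto_climb_const (A : ℕ) : Tendsto (fun L : ℕ => climb A L) atTop (𝓝 0) := by
  rcases Nat.eq_zero_or_pos A with rfl | hA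
  · have h0 : (fun L : ℕ => climb 0 L) = fun _ => 0 := by
      funext L
      simp only [climb, climbEvt_zero_left, measureReal_empty]
    rw [h0]
    exact tendsto_const_nhds
  · set S : Set (Site 3) := {z : Site 3 | -(A : ℤ) < z 0} with hS
    set μ : Measure (BondConfig (Site 3)) := bondPercolation (zdGraph 3) (criticalProbI 3) with hμ
    -- the decreasing `reach` events
    set R : ℕ → Set (BondConfig (Site 3)) :=
      fun n => {ω | ∃ y : Site 3, (n : ℤ) ≤ y 0 ∧ ω ∈ openConnIn S 0 y} with hR
    have hRmeas : ∀ n, MeasurableSet (R n) := by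
      intro n
      have hset : R n = ⋃ y ∈ {y : Site 3 | (n : ℤ) ≤ y 0}, openConnIn S 0 y := by
        ext ω
        simp only [hR, Set.mem_setOf_eq, Set.mem_iUnion, exists_prop]
      rw [hset]
      exact MeasurableSet.biUnion (Set.to_countable _) fun y _ =>
        measurableSet_openConnIn_of_countable _ _ _
    have hRanti : Antitone R := by
      intro m n hmn ω hω
      obtain ⟨y, hy, hc⟩ := hω
      exact ⟨y, le_trans (by exact_mod_cast hmn) hy, hc⟩
    have h0S : (0 : Site 3) ∈ S := by
      simp only [hS, Set.mem_setOf_eq, Pi.zero_apply]; omega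
    -- no percolation in `R(A)` at `p_c` (BGN at depth `A`)
    have hperc : μ (percolatesVia (withinGraph (zdGraph 3) S) 0) = 0 := by
      have hSeq : S = {y : Site 3 | -(A : ℤ) + 1 ≤ y 0} := by
        ext z; simp only [hS, Set.mem_setOf_eq]; omega
      have hreal := FreeBoxSparse.StubCeiling.real_percolatesVia_halfSpace_depth (-(A : ℤ) + 1) 0
        (by rw [Pi.zero_apply]; omega)
      rw [hSeq, ← measureReal_eq_zero_iff (measure_ne_top _ _)]
      exact hreal
    -- the intersection of the reach events is a.s. inside the percolation event
    have hle : μ (⋂ n, R n) ≤ μ (percolatesVia (withinGraph (zdGraph 3) S) 0) := by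
      refine measure_mono_ae ?_
      filter_upwards [(ProbabilityTheory.setBernoulli_ae_subset :
        ∀ᵐ ω ∂μ, ω ⊆ (zdGraph 3).edgeSet)] with ω hω hmem
      refine FreeBoxSparse.StubCeiling.percolatesVia_of_infinite h0S hω ?_
      have hmem' : ∀ n : ℕ, ω ∈ R n := fun n => Set.mem_iInter.1 hmem n
      by_contra hfin
      rw [Set.not_infinite] at hfin
      obtain ⟨M, hM⟩ := (hfin.image fun y : Site 3 => y 0).bddAbove
      obtain ⟨y, hyn, hy⟩ := hmem' (M.toNat + 1)
      have h1 : y 0 ≤ M := hM (Set.mem_image_of_mem _ hy)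
      have h2 : M < ((M.toNat + 1 : ℕ) : ℤ) := by push_cast; omega
      omega
    have hnull : μ (⋂ n, R n) = 0 := nonpos_iff_eq_zero.1 (hperc ▸ hle)
    have hlim := tendsto_measure_iInter_atTop (μ := μ)
      (fun n => (hRmeas n).nullMeasurableSet) hRanti ⟨0, measure_ne_top _ _⟩
    rw [hnull] at hlim
    have hlim' : Tendsto (fun n => (μ (R n)).toReal) atTop (𝓝 0) := by
      have h := (ENNReal.tendsto_toReal ENNReal.zero_ne_top).comp hlim
      rw [ENNReal.toReal_zero] at h
      exact h
    refine squeeze_zero (fun n => measureReal_nonneg) (fun n => ?_) hlim'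
    show μ.real (climbEvt A n) ≤ (μ (R n)).toReal
    rw [← measureReal_def]
    exact measureReal_mono (fun ω ⟨y, hy, hc⟩ => ⟨y, hy.symm.le, hc⟩) (measure_ne_top _ _)

/-- **WITNESS (F3 / BC5): the rung family at the floor parameter is PROVED** — `ProfileBGN`
holds for the constant profiles (Barsky–Grimmett–Newman at every fixed depth). -/
theorem profileBGN_constProfiles : ProfileBGN constProfiles := by
  rintro g ⟨A, rfl⟩
  exact tendsto_climb_const A

example : ProfileBGN constProfiles := profileBGN_constProfiles

/-! ### Registered stubs and the composition -/

/-! Name-keyed aliases of the stub statements (convention of `Lines/birth.lean`): the native skeleton audit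
admits a hypothesis of the composition iff its head constant carries a registered stub's short name. -/
namespace __Registered

/-- Alias of `SublinearProfileBGN` keyed by the registered stub name. -/
abbrev stub_sublinearProfileBGN : Prop := SublinearProfileBGN
/-- Alias of the passage statement keyed by the registered stub name. -/
abbrev stub_passageToLinearDepth : Prop := SublinearProfileBGN → LinearDepthBGN

end __Registered

/-- **stub 1 — the RUNG** (prover target): BGN along every sublinearly receding floor. -/
theorem stub_sublinearProfileBGN : SublinearProfileBGN := by
  sorry

/-- **stub 2 — the PASSAGE sublinear → linear depth** (the limit step of the profile ladder; this is
the X_D wall: summit-strength modulo `PercFiniteBoxLRO.LinearScaleLROOfTheta`, p153598; flagged,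
NOT a prover target). -/
theorem stub_passageToLinearDepth : SublinearProfileBGN → LinearDepthBGN := by
  sorry

/-- **Composition** (the skeleton; FIRST theorem of the file concluding the crux): the two stubs give the
crux BY NAME (`lim ⇒ liminf` at the top of the ladder). -/
theorem BGNOffTheFloor_of (h₁ : __Registered.stub_sublinearProfileBGN)
    (h₂ : __Registered.stub_passageToLinearDepth) :
    Theses.PercGamblersRuin.BGNOffTheFloor := by
  intro a b hab ε hε
  exact ((tendsto_order.1 (h₂ h₁ a b hab)).2 ε hε).frequently

/-- The same composition with the statements spelled out. -/
theorem BGNOffTheFloor_of' :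
    SublinearProfileBGN → (SublinearProfileBGN → LinearDepthBGN) →
      Theses.PercGamblersRuin.BGNOffTheFloor :=
  fun h₁ h₂ => BGNOffTheFloor_of h₁ h₂

/-- `LinearDepthBGN → BGNOffTheFloor` (`lim ⇒ liminf`): the top of the ladder gives the crux (stated after the
skeleton on purpose: the skeleton lint takes the first theorem concluding the crux). -/
theorem bgnOffTheFloor_of_linearDepthBGN (h : LinearDepthBGN) :
    Theses.PercGamblersRuin.BGNOffTheFloor := by
  intro a b hab ε hε
  exact ((tendsto_order.1 (h a b hab)).2 ε hε).frequently

end Summit.CriticalPhenomena.PercolationContinuityZ3.Cruxes.BGNOffTheFloor.ProfileLadder
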